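import Mathlib
import Summits.NavierStokesRegularity.NavierStokesRegularity.Theorems.TaoLadderRungTwoBreakBlowupRigidityOnePeriodicCompanionBounded
import HarnessLib

/-!
# Every SHIFT-PERIODIC admissible eternal solution is UNIFORMLY BOUNDED — so `UniformBound` is redundant in the
  dictionary «DSS waves = shift-periodic bounded eternal solutions» (K2(1) `TaoLadderRungTwoBreak.BlowupRigidityOne`,
  stmt-NavierStokesRegularity-20206, classification stub)

Route-independent (no `Theses` import). MODEL lattice ODEs only (Tao 2016 §4 (4.8), §6.4; cell vocabulary); nothing
here is a statement about the Navier–Stokes equations; NO item is closed (`--supports stmt-NavierStokesRegularity-20206`).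
General `m`; DEF-FREE.

* `shiftPeriodic_shift_nat` — `W n σ = W (n + kq) (σ + kqT)` (the period relation read upward);
* `uniformBound_of_shiftPeriodic` — an admissible eternal solution with `W_{n+q}(σ) = W_n(σ - qT)` (`q ≥ 1`, `T > 0`) is
  uniformly bounded: its `q` profiles form an admissible DSS wave (`isDSSWave_of_shiftPeriodic`), DSS profiles are
  bounded (`IsDSSWave.uniformBound`, tree), and every shell is a translate of a base profile;
* `exists_survivingDSSWave_iff_shiftPeriodic'` — the existence-level dictionary of p819433 with the `UniformBound`
  clause DROPPED from the eternal side: a table carries a non-trivial (S₁)-surviving admissible DSS wave iff it carries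
  a shift-periodic (`q ≥ 1`, `T > 0`, `μ < 1`) admissible eternal solution surviving forward.

HONEST LABEL: dictionary; nothing about the open content (existence / rigidity); no stub, crux or summit is proved; rung 0.
-/

noncomputable section

-- the summit and its single sub-problem share the name (CONVENTIONS §1)
set_option linter.dupNamespace false

open Set Filter Topology MeasureTheory

namespace Summit.NavierStokesRegularity.NavierStokesRegularity.Theorems

namespace BlowupRigidityOne

open Literature.Analysis.FluidPDE Literature.Analysis.FluidPDE.TaoCascade

variable {m : ℕ}

/-- The period relation read upward: `W n σ = W (n + kq) (σ + kqT)` for `k ∈ ℕ`.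
[cite: Tao2016AveragedNS, §4 Lemma 4.1 (4.8) in self-similar variables; cell vocabulary] -/
theorem shiftPeriodic_shift_nat {W : ℤ → ℝ → Em m} {q : ℕ} {T : ℝ}
    (hper : ∀ (n : ℤ) (σ : ℝ), W (n + q) σ = W n (σ - q * T)) (k : ℕ) (n : ℤ) (σ : ℝ) :
    W n σ = W (n + (k : ℤ) * (q : ℤ)) (σ + (k : ℝ) * (q : ℝ) * T) := by
  rw [shiftPeriodic_iterate hper k n]
  ring_nf

/-- **A shift-periodic admissible eternal solution is uniformly bounded.** [cite: Tao2016AveragedNS, §4 Lemma 4.1 (4.8); cell theorem (`IsDSSWave.uniformBound`) + dictionary] -/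
theorem uniformBound_of_shiftPeriodic {ε₀ T : ℝ} {α : Fin m → Fin m → Fin m → ℤ × ℤ × ℤ → ℝ}
    {W : ℤ → ℝ → Em m} (hW : IsEternal ε₀ α W) {q : ℕ} (hq : 0 < q) (hT : 0 < T)
    (hper : ∀ (n : ℤ) (σ : ℝ), W (n + q) σ = W n (σ - q * T)) : UniformBound W := by
  obtain ⟨p, rfl⟩ := Nat.exists_eq_succ_of_ne_zero hq.ne'
  obtain ⟨C, hC⟩ := (isDSSWave_of_shiftPeriodic hW hT hper).uniformBound
  -- base shells `0 ≤ r < q` are bounded everywhere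
  have hbase : ∀ (r : ℕ), r < p + 1 → ∀ y : ℝ, ‖W (r : ℤ) y‖ ≤ C := by
    intro r hr y
    have h := hC ⟨r, hr⟩ (y - (r : ℝ) * T)
    simp only [sub_add_cancel] at h
    exact h
  refine ⟨C, fun n σ => ?_⟩
  -- move `n` up by a multiple of the period into `ℕ`, then reduce modulo `q`
  obtain ⟨k, hk⟩ : ∃ k : ℕ, 0 ≤ n + (k : ℤ) * ((p + 1 : ℕ) : ℤ) := by
    refine ⟨n.natAbs, ?_⟩
    have h1 : (n.natAbs : ℤ) * ((p + 1 : ℕ) : ℤ) ≥ (n.natAbs : ℤ) * 1 :=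
      mul_le_mul_of_nonneg_left (by exact_mod_cast Nat.succ_pos p) (Int.natCast_nonneg _)
    have h2 : -n ≤ (n.natAbs : ℤ) := by
      rw [Int.natCast_natAbs]; exact neg_le_abs n
    linarith
  rw [shiftPeriodic_shift_nat hper k n σ]
  obtain ⟨N, hN⟩ := Int.eq_ofNat_of_zero_le hk
  rw [hN, shiftPeriodic_reduce hper N]
  exact hbase _ (Nat.mod_lt _ (Nat.succ_pos p)) _

/-- **DSS WAVES = SHIFT-PERIODIC ADMISSIBLE ETERNAL SOLUTIONS (existence level), `UniformBound` dropped.**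
[cite: Tao2016AveragedNS, §4 Lemma 4.1 (iii) (4.8), §6.4; cell vocabulary (`IsDSSWave`, `Surviving`, `IsEternal`, `EternalSurvivingFwd`)] -/
theorem exists_survivingDSSWave_iff_shiftPeriodic' {ε₀ : ℝ} (hε : 0 < ε₀)
    {α : Fin m → Fin m → Fin m → ℤ × ℤ × ℤ → ℝ} :
    (∃ (q : ℕ) (π : Equiv.Perm (Fin q)) (T : ℝ) (Φ : Fin q → ℝ → Em m),
        IsDSSWave ε₀ α π T Φ ∧ Surviving 1 ε₀ T ∧ ∃ r x, Φ r x ≠ 0) ↔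
    (∃ (W : ℤ → ℝ → Em m) (q : ℕ) (T : ℝ), 0 < q ∧ 0 < T ∧ dssMu ε₀ T < 1 ∧
        IsEternal ε₀ α W ∧ (∀ (n : ℤ) (σ : ℝ), W (n + q) σ = W n (σ - q * T)) ∧ EternalSurvivingFwd 1 ε₀ W) := by
  rw [exists_survivingDSSWave_iff_shiftPeriodic hε]
  constructor
  · rintro ⟨W, q, T, hq, hT, hμ, hW, -, hper, hS⟩
    exact ⟨W, q, T, hq, hT, hμ, hW, hper, hS⟩
  · rintro ⟨W, q, T, hq, hT, hμ, hW, hper, hS⟩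
    exact ⟨W, q, T, hq, hT, hμ, hW, uniformBound_of_shiftPeriodic hW hq hT hper, hper, hS⟩

end BlowupRigidityOne

end Summit.NavierStokesRegularity.NavierStokesRegularity.Theorems

end
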